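import Summits.Ventures.LatticeQCDFlow.Scaling.SimulatedTemperingCommonMode
import Summits.Ventures.LatticeQCDFlow.Scaling.SimulatedTemperingModeTorpid
import Summits.Ventures.LatticeQCDFlow.Scaling.ReplicaExchangeCommonMode
import Summits.Ventures.LatticeQCDFlow.Scaling.ReplicaExchangeModeTorpid
import Literature.Probability.MarkovChains.RelaxationTimeLowerBound
import Literature.Probability.MarkovChains.ConvergenceTheorem
import Literature.Probability.MarkovChains.ErgodicSumVariance

/-!
HONEST FRAMING: exact (Metropolis-corrected) sampling algorithms for lattice gauge theory; figures
of merit are autocorrelation/cost numbers at stated couplings and volumes; no continuum-physics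
claim.

# TemperingMixingTimeFloor — A GAP CEILING IS A COLD-START FLOOR: `Gap ≤ u < 1 ⇒ t_mix(ε) ≥ (1/u − 1)·log(1/(2ε))`;
# FOR TEMPERING, EVERY SLOW MODE COMMON TO ALL LEVELS AND EVERY THIN SECTOR BOUNDARY IS SUCH A CEILING
# (lean-2 GEN-17, ours)

Venture-side (OURS).  Cell `lqcd-flow` (pub-lqcd), unit `pub-lqcd-lean-2-g17`, 2026-08-25.  Companion of
`Scaling/SimulatedTemperingMixingTime` (mixing-time CEILINGS from gap floors): here the gap CEILINGS of chapter Z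
(`Scaling/SimulatedTemperingCommonMode`, `Scaling/ReplicaExchangeCommonMode`: a configuration observable `h` slow at
every level; `Scaling/SimulatedTemperingModeTorpid`, `Scaling/ReplicaExchangeModeTorpid`: a sector `A` with thin
boundary at every level) become mixing-time FLOORS through Levin–Peres–Wilmer Theorem 12.5
(`RelaxationTimeLowerBound.LevinPeres2017_thm_12_5_tmix`, PROVED in the tree: an eigenvalue `λ ≠ 1`, `|λ| < 1` forces
`t_mix(ε) ≥ (1/(1−|λ|) − 1)log(1/(2ε))`), applied to the second eigenvalue `λ₂ = 1 − γ`
(`SpectralGapVariational.exists_eigenfunction_spectralGap`).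

## What is proved

* §1 generic, for `P` row-stochastic, reversible w.r.t. a positive probability vector `π`, irreducible, `|X| ≥ 2`:
  **`mixingTime_ge_of_spectralGap_le`** — `γ(P) ≤ u < 1`, `0 < ε ≤ ½` and SOME time mixing to within `ε`
  (`∃ n, d(n) ≤ ε`) ⇒ `(1/u − 1)·log(1/(2ε)) ≤ t_mix(ε)`; **`mixingTime_ge_of_spectralGap_le_of_aperiodic`** — the
  same with the proviso discharged by aperiodicity (`ConvergenceTheorem.exists_worstTvDist_le`).
* §2 simulated tempering (`K ≥ 1`, `0 < t < 1`, aperiodic sampler — `stFinSampler_isAperiodic_of_diag`: positive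
  diagonals `M_k(x,x) > 0` suffice):
  **`stFin_mixingTime_ge_commonMode`** — for every configuration observable `h` with
  `(1−t)Σ_k𝓔_{μ_k}(M_k;h) < Σ_kVar_{μ_k}(h)`: `t_mix(ε) ≥ (Σ_kVar_k(h)/((1−t)Σ_k𝓔_k(h)) − 1)·log(1/(2ε))`;
  **`stFin_mixingTime_ge_sector`** — for every sector `A` (`m_A = Σ_kμ_k(A) ∈ (0, K+1)`) whose ceiling
  `u_A = (1−t)(K+1)Σ_kQ_k(A,Aᶜ)/(m_A((K+1)−m_A))` is `< 1`: `t_mix(ε) ≥ (1/u_A − 1)·log(1/(2ε))`.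
* §3 replica exchange (same provisos; `ptFinUpdate_self`, `ptFinSampler_isAperiodic_of_diag`):
  **`ptFin_mixingTime_ge_commonMode`** — `t_mix(ε) ≥
  ((K+1)Σ_kVar_k(h)/((1−t)Σ_k𝓔_k(h)) − 1)·log(1/(2ε))`; **`ptFin_mixingTime_ge_sector`** —
  `t_mix(ε) ≥ ((K+1)Σ_kμ_k(A)μ_k(Aᶜ)/((1−t)Σ_kQ_k(A,Aᶜ)) − 1)·log(1/(2ε))`.

Reading (no numerics implied): a topological sector that every level's update leaves at stationary rate `≤ ε₀`
keeps BOTH samplers `Ω(1/ε₀)` steps (PT: `Ω((K+1)/ε₀)` single-replica steps) away from equilibrium from a worst-case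
start, with the `log(1/(2ε))` accuracy factor — tempering redistributes the crossing over the ladder, it does not
remove it.  NOT CLAIMED: the proviso-free statement for periodic samplers (no mixing time exists there); anything
measured.  Literature grade (cell rule): TEXTBOOK (Thm 12.5, PROVED in the tree) + chapter Z ceilings; NEW TYPING; no
new bib keys.
-/

noncomputable section

open Finset
open Literature.Probability.MarkovChains

namespace Summit.Ventures.LatticeQCDFlow.Scaling

/-! ## §1 A gap ceiling is a mixing-time floor -/

section Generic

variable {X : Type*} [Fintype X] [DecidableEq X] {P : Matrix X X ℝ} {π : X → ℝ}

/-- **`γ(P) ≤ u < 1 ⇒ t_mix(ε) ≥ (1/u − 1)·log(1/(2ε))`** (reversible irreducible `P`, positive probability vector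
`π`, `|X| ≥ 2`, `0 < ε ≤ ½`, provided some time mixes to within `ε`): Theorem 12.5 at the eigenvalue
`λ₂ = 1 − γ ∈ (0,1)`. [ours] -/
theorem mixingTime_ge_of_spectralGap_le [Nontrivial X] (hπ : ∀ x, 0 < π x) (hπ1 : ∑ x, π x = 1)
    (hP : IsRowStochastic P) (hDB : DetailedBalance π P) (hirr : IsIrreducible P) {u : ℝ}
    (hgap : spectralGap π P ≤ u) (hu1 : u < 1) {ε : ℝ} (hε : 0 < ε) (hε2 : ε ≤ 1 / 2)
    (hmix : ∃ n, worstTvDist P π n ≤ ε) :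
    (1 / u - 1) * Real.log (1 / (2 * ε)) ≤ (mixingTime P π ε : ℝ) := by
  have hγ0 : 0 < spectralGap π P := spectralGap_pos hπ hπ1 hP hDB hirr
  have hu0 : 0 < u := lt_of_lt_of_le hγ0 hgap
  obtain ⟨g, -, hg1, -, hPg⟩ := exists_eigenfunction_spectralGap hπ hπ1 hP hDB
  set lam : ℝ := secondEigenvalue π P with hlam
  have hlamγ : lam = 1 - spectralGap π P := by simp only [hlam, spectralGap]; ring
  have hlam0 : 0 < lam := by rw [hlamγ]; linarith
  have hlam1 : lam < 1 := by rw [hlamγ]; linarith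
  -- the eigenpair over `ℂ`
  have hf : ∀ x, ∑ y, ((P x y : ℝ) : ℂ) * ((g y : ℝ) : ℂ) = (lam : ℂ) * ((g x : ℝ) : ℂ) := by
    intro x
    have h := congrFun hPg x
    simp only [Matrix.mulVec, dotProduct, Pi.smul_apply, smul_eq_mul] at h
    exact_mod_cast h
  have hf0 : (fun x => ((g x : ℝ) : ℂ)) ≠ 0 := by
    intro h0
    have hg0 : ∀ x, g x = 0 := fun x => by
      have h1 : ((g x : ℝ) : ℂ) = 0 := congrFun h0 x
      exact_mod_cast h1
    have : piInner π g g = 0 := by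
      unfold piInner
      exact Finset.sum_eq_zero fun x _ => by rw [hg0 x]; ring
    rw [this] at hg1
    exact zero_ne_one hg1
  have hne1 : (lam : ℂ) ≠ 1 := by
    intro h
    have : lam = 1 := by exact_mod_cast h
    linarith
  have hnorm : ‖(lam : ℂ)‖ = lam := Complex.norm_of_nonneg hlam0.le
  have hlt1 : ‖(lam : ℂ)‖ < 1 := by rw [hnorm]; exact hlam1
  have h125 := LevinPeres2017_thm_12_5_tmix (hDB.isStationary hP.2) hf hf0 hne1 hlt1 hε hmix
  rw [hnorm] at h125
  refine le_trans ?_ h125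
  have hlog : 0 ≤ Real.log (1 / (2 * ε)) := Real.log_nonneg (by rw [le_div_iff₀ (by positivity)]; linarith)
  refine mul_le_mul_of_nonneg_right ?_ hlog
  -- `1/u ≤ 1/γ = 1/(1 − λ₂)`
  have : 1 - lam = spectralGap π P := by rw [hlamγ]; ring
  rw [this]
  exact sub_le_sub_right (one_div_le_one_div_of_le hγ0 hgap) 1

/-- The same floor with the mixing proviso discharged by APERIODICITY. [ours] -/
theorem mixingTime_ge_of_spectralGap_le_of_aperiodic [Nontrivial X] (hπ : ∀ x, 0 < π x) (hπ1 : ∑ x, π x = 1)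
    (hP : IsRowStochastic P) (hDB : DetailedBalance π P) (hirr : IsIrreducible P) (hap : IsAperiodic P)
    {u : ℝ} (hgap : spectralGap π P ≤ u) (hu1 : u < 1) {ε : ℝ} (hε : 0 < ε) (hε2 : ε ≤ 1 / 2) :
    (1 / u - 1) * Real.log (1 / (2 * ε)) ≤ (mixingTime P π ε : ℝ) :=
  mixingTime_ge_of_spectralGap_le hπ hπ1 hP hDB hirr hgap hu1 hε hε2
    (exists_worstTvDist_le hP hirr hap (hDB.isStationary hP.2) (fun x => (hπ x).le) hπ1 hε)

end Generic

/-! ## §2 Simulated tempering -/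

section SimulatedTempering

variable {S : Type*} [Fintype S] [DecidableEq S] {K : ℕ} {μ : Fin (K + 1) → S → ℝ}
  {M : Fin (K + 1) → Matrix S S ℝ} {t : ℝ}

/-- **The proviso is cheap:** if every within-level update holds with positive probability (`M_k(x,x) > 0`, as a
Metropolis or heat-bath update does) and `t < 1`, the tempering sampler has positive diagonal, hence is APERIODIC.
[ours] -/
theorem stFinSampler_isAperiodic_of_diag (hμ : ∀ k x, 0 < μ k x) (ht0 : 0 ≤ t) (ht1 : t < 1)
    (hMdiag : ∀ k x, 0 < M k x x) : IsAperiodic (stFinSampler t μ M) := by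
  refine isAperiodic_of_diag_pos fun p => ?_
  rw [stFinSampler_apply, stFinWithin_apply, if_pos rfl]
  have hL : 0 ≤ stFinLevel μ p p := (stFinLevel_isRowStochastic hμ).1 p p
  have h1t : 0 < 1 - t := by linarith
  nlinarith [mul_pos h1t (hMdiag p.1 p.2), mul_nonneg ht0 hL]

variable (hK : 1 ≤ K) (hμ : ∀ k x, 0 < μ k x) (hμ1 : ∀ k, ∑ x, μ k x = 1) (hM : ∀ k, IsRowStochastic (M k))
  (hMrev : ∀ k, DetailedBalance (μ k) (M k)) (hMirr : ∀ k, IsIrreducible (M k)) (ht0 : 0 < t) (ht1 : t < 1)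
  (hap : IsAperiodic (stFinSampler t μ M))
include hK hμ hμ1 hM hMrev hMirr ht0 ht1 hap

/-- **A SLOW MODE COMMON TO ALL LEVELS IS A COLD-START FLOOR FOR TEMPERING:** for every configuration observable `h`
with `(1−t)Σ_k𝓔_k(h) < Σ_kVar_k(h)` and every `0 < ε ≤ ½`,
`t_mix(ε) ≥ (Σ_kVar_{μ_k}(h)/((1−t)Σ_k𝓔_{μ_k}(M_k;h)) − 1)·log(1/(2ε))`. [ours] -/
theorem stFin_mixingTime_ge_commonMode (h : S → ℝ) (hE : 0 < ∑ k, dirichletForm (μ k) (M k) h)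
    (hslow : (1 - t) * ∑ k, dirichletForm (μ k) (M k) h < ∑ k, lawVariance (μ k) h)
    {ε : ℝ} (hε : 0 < ε) (hε2 : ε ≤ 1 / 2) :
    ((∑ k, lawVariance (μ k) h) / ((1 - t) * ∑ k, dirichletForm (μ k) (M k) h) - 1) * Real.log (1 / (2 * ε))
      ≤ (mixingTime (stFinSampler t μ M) (stFinLaw μ) ε : ℝ) := by
  haveI : Nonempty S := by
    by_contra hS
    rw [not_nonempty_iff] at hS
    have := hμ1 0
    rw [Finset.univ_eq_empty, Finset.sum_empty] at this
    exact zero_ne_one this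
  haveI : Nontrivial (Fin (K + 1)) := Fin.nontrivial_iff_two_le.mpr (by omega)
  have h1t : 0 < 1 - t := by linarith
  have hD : 0 < (1 - t) * ∑ k, dirichletForm (μ k) (M k) h := mul_pos h1t hE
  have hV : 0 < ∑ k, lawVariance (μ k) h := hD.trans hslow
  have hgap := stFin_spectralGap_le_commonMode hK hμ hμ1 hM hMrev ht0.le ht1.le h hV
  have hu1 : (1 - t) * (∑ k, dirichletForm (μ k) (M k) h) / ∑ k, lawVariance (μ k) h < 1 := by
    rw [div_lt_one hV]; exact hslow
  have hmain := mixingTime_ge_of_spectralGap_le_of_aperiodic (stFinLaw_pos hμ) (sum_stFinLaw hμ1)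
    (stFinSampler_isRowStochastic hμ hM ht0.le ht1.le) (stFinSampler_detailedBalance hμ hMrev)
    (stFinSampler_isIrreducible hμ hM hMirr ht0 ht1) hap hgap hu1 hε hε2
  rwa [one_div_div] at hmain

omit hK in
/-- **A THIN SECTOR BOUNDARY AT EVERY LEVEL IS A COLD-START FLOOR FOR TEMPERING:** for every sector `A` with
`m_A = Σ_kμ_k(A) ∈ (0, K+1)` and ceiling `u_A = (1−t)(K+1)Σ_kQ_k(A,Aᶜ)/(m_A((K+1)−m_A)) < 1`:
`t_mix(ε) ≥ (1/u_A − 1)·log(1/(2ε))`. [ours] -/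
theorem stFin_mixingTime_ge_sector (A : Finset S) (hA0 : 0 < ∑ k, ∑ x ∈ A, μ k x)
    (hA1 : ∑ k, ∑ x ∈ A, μ k x < K + 1)
    (hslow : (1 - t) * (K + 1) * (∑ k, edgeMeasure (μ k) (M k) A Aᶜ)
      / ((∑ k, ∑ x ∈ A, μ k x) * ((K + 1) - ∑ k, ∑ x ∈ A, μ k x)) < 1)
    {ε : ℝ} (hε : 0 < ε) (hε2 : ε ≤ 1 / 2) :
    (1 / ((1 - t) * (K + 1) * (∑ k, edgeMeasure (μ k) (M k) A Aᶜ)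
        / ((∑ k, ∑ x ∈ A, μ k x) * ((K + 1) - ∑ k, ∑ x ∈ A, μ k x))) - 1) * Real.log (1 / (2 * ε))
      ≤ (mixingTime (stFinSampler t μ M) (stFinLaw μ) ε : ℝ) := by
  haveI := stFin_nontrivial_of_mass hμ1 hA0 hA1
  exact mixingTime_ge_of_spectralGap_le_of_aperiodic (stFinLaw_pos hμ) (sum_stFinLaw hμ1)
    (stFinSampler_isRowStochastic hμ hM ht0.le ht1.le) (stFinSampler_detailedBalance hμ hMrev)
    (stFinSampler_isIrreducible hμ hM hMirr ht0 ht1) hap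
    (stFin_spectralGap_le_sector hμ hμ1 hM hMrev ht0.le ht1.le A hA0 hA1) hslow hε hε2

end SimulatedTempering

/-! ## §3 Replica exchange -/

section ReplicaExchange

variable {S : Type*} [Fintype S] [DecidableEq S] {K : ℕ} {μ : Fin (K + 1) → S → ℝ}
  {M : Fin (K + 1) → S → S → ℝ} {t : ℝ}

omit [Fintype S] in
/-- The product replica update holds with probability `(K+1)⁻¹Σ_k M_k(x_k,x_k)`. [ours] -/
theorem ptFinUpdate_self (M : Fin (K + 1) → S → S → ℝ) (p : Fin (K + 1) × (Fin (K + 1) → S)) :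
    ptFinUpdate M p p = ∑ k, (1 : ℝ) / (K + 1) * M k (p.2 k) (p.2 k) := by
  rw [ptFinUpdate_apply, if_pos rfl, prodKernel_apply]
  refine sum_congr rfl fun k _ => ?_
  unfold coordKernel
  rw [if_pos (by simp)]

/-- **The proviso is cheap (replica exchange):** positive-diagonal replica updates and `t < 1` make the sampler
APERIODIC. [ours] -/
theorem ptFinSampler_isAperiodic_of_diag (hμ : ∀ k x, 0 < μ k x) (ht0 : 0 ≤ t) (ht1 : t < 1)
    (hMdiag : ∀ k x, 0 < M k x x) : IsAperiodic (ptFinSampler t μ M) := by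
  refine isAperiodic_of_diag_pos fun p => ?_
  rw [ptFinSampler_apply, ptFinUpdate_self]
  have hS : 0 ≤ ptFinSwap μ p p := (ptFinSwap_isRowStochastic hμ).1 p p
  have h1t : 0 < 1 - t := by linarith
  have hU : 0 < ∑ k, (1 : ℝ) / (K + 1) * M k (p.2 k) (p.2 k) :=
    Finset.sum_pos (fun k _ => mul_pos (by positivity) (hMdiag k (p.2 k))) univ_nonempty
  nlinarith [mul_pos h1t hU, mul_nonneg ht0 hS]

variable (hK : 1 ≤ K) (hμ : ∀ k x, 0 < μ k x) (hμ1 : ∀ k, ∑ x, μ k x = 1) (hM : ∀ k, IsRowStochastic (M k))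
  (hMrev : ∀ k, DetailedBalance (μ k) (M k)) (ht0 : 0 ≤ t) (ht1 : t ≤ 1)
  (hirr : IsIrreducible (ptFinSampler t μ M)) (hap : IsAperiodic (ptFinSampler t μ M))
include hK hμ hμ1 hM hMrev ht0 ht1 hirr hap

/-- **A SLOW MODE COMMON TO ALL LEVELS IS A COLD-START FLOOR FOR REPLICA EXCHANGE:** for every configuration
observable `h` with `(1−t)Σ_k𝓔_k(h) < (K+1)Σ_kVar_k(h)` and every `0 < ε ≤ ½`,
`t_mix(ε) ≥ ((K+1)Σ_kVar_k(h)/((1−t)Σ_k𝓔_k(h)) − 1)·log(1/(2ε))` (irreducible aperiodic sampler, `|S| ≥ 2`). [ours] -/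
theorem ptFin_mixingTime_ge_commonMode [Nontrivial S] (h : S → ℝ) (hE : 0 < ∑ k, dirichletForm (μ k) (M k) h)
    (h1t : t < 1) (hslow : (1 - t) * ∑ k, dirichletForm (μ k) (M k) h < (K + 1) * ∑ k, lawVariance (μ k) h)
    {ε : ℝ} (hε : 0 < ε) (hε2 : ε ≤ 1 / 2) :
    (((K + 1) * ∑ k, lawVariance (μ k) h) / ((1 - t) * ∑ k, dirichletForm (μ k) (M k) h) - 1)
        * Real.log (1 / (2 * ε))
      ≤ (mixingTime (ptFinSampler t μ M) (ptFinLaw μ) ε : ℝ) := by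
  have h1t' : 0 < 1 - t := by linarith
  have hD : 0 < (1 - t) * ∑ k, dirichletForm (μ k) (M k) h := mul_pos h1t' hE
  have hKV : 0 < (K + 1 : ℝ) * ∑ k, lawVariance (μ k) h := hD.trans hslow
  have hV : 0 < ∑ k, lawVariance (μ k) h := by
    by_contra hle
    push Not at hle
    have : (K + 1 : ℝ) * ∑ k, lawVariance (μ k) h ≤ 0 := mul_nonpos_of_nonneg_of_nonpos (by positivity) hle
    linarith
  have hgap := ptFin_spectralGap_le_commonMode hK hμ hμ1 hM hMrev ht0 ht1 h hV
  have hu1 : (1 - t) * (∑ k, dirichletForm (μ k) (M k) h) / ((K + 1) * ∑ k, lawVariance (μ k) h) < 1 := by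
    rw [div_lt_one hKV]; exact hslow
  have hmain := mixingTime_ge_of_spectralGap_le_of_aperiodic (ptFinLaw_pos hμ) (sum_ptFinLaw hμ1)
    (ptFinSampler_isRowStochastic hμ hM ht0 ht1) (ptFinSampler_detailedBalance hμ hMrev) hirr hap hgap hu1 hε hε2
  rwa [one_div_div] at hmain

/-- **A THIN SECTOR BOUNDARY AT EVERY LEVEL IS A COLD-START FLOOR FOR REPLICA EXCHANGE:** for every sector `A` with
`Σ_kμ_k(A)μ_k(Aᶜ) > 0` and `(1−t)Σ_kQ_k(A,Aᶜ) < (K+1)Σ_kμ_k(A)μ_k(Aᶜ)` (read the bound as vacuous when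
`Σ_kQ_k(A,Aᶜ) = 0`: Lean's `x/0 = 0`):
`t_mix(ε) ≥ ((K+1)Σ_kμ_k(A)μ_k(Aᶜ)/((1−t)Σ_kQ_k(A,Aᶜ)) − 1)·log(1/(2ε))`. [ours] -/
theorem ptFin_mixingTime_ge_sector [Nontrivial S] (A : Finset S)
    (hA : 0 < ∑ k, (∑ x ∈ A, μ k x) * ∑ x ∈ Aᶜ, μ k x)
    (hslow : (1 - t) * ∑ k, edgeMeasure (μ k) (M k) A Aᶜ < (K + 1) * ∑ k, (∑ x ∈ A, μ k x) * ∑ x ∈ Aᶜ, μ k x)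
    {ε : ℝ} (hε : 0 < ε) (hε2 : ε ≤ 1 / 2) :
    (((K + 1) * ∑ k, (∑ x ∈ A, μ k x) * ∑ x ∈ Aᶜ, μ k x) / ((1 - t) * ∑ k, edgeMeasure (μ k) (M k) A Aᶜ) - 1)
        * Real.log (1 / (2 * ε))
      ≤ (mixingTime (ptFinSampler t μ M) (ptFinLaw μ) ε : ℝ) := by
  have hKV : 0 < (K + 1 : ℝ) * ∑ k, (∑ x ∈ A, μ k x) * ∑ x ∈ Aᶜ, μ k x := by positivity
  have hgap := ptFin_spectralGap_le_sector hK hμ hμ1 hM hMrev ht0 ht1 A hA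
  have hu1 : (1 - t) * (∑ k, edgeMeasure (μ k) (M k) A Aᶜ)
      / ((K + 1) * ∑ k, (∑ x ∈ A, μ k x) * ∑ x ∈ Aᶜ, μ k x) < 1 := by
    rw [div_lt_one hKV]; exact hslow
  have hmain := mixingTime_ge_of_spectralGap_le_of_aperiodic (ptFinLaw_pos hμ) (sum_ptFinLaw hμ1)
    (ptFinSampler_isRowStochastic hμ hM ht0 ht1) (ptFinSampler_detailedBalance hμ hMrev) hirr hap hgap hu1 hε hε2
  rwa [one_div_div] at hmain

end ReplicaExchange

end Summit.Ventures.LatticeQCDFlow.Scaling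

end
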